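import Summits.QuantumFields.YangMills.Theorems.FluctuationComparisonRegPrIntLS2BetaSeamTwistWords
import HarnessLib

/-!
# (RG-K) THE ℤ₂ SEAM TWIST, II — DESCENT: the seam twist of one lattice direction commutes with the block averaging of record (0.4), hence
# with `descendTo`; it fixes every plaquette variable, the Wilson action, the small-field guards and the good histories; it is an involution

Sequel of `…S2BetaSeamTwistWords` (crux `stmt-QuantumFields-20520`, LINE `semiclassical_s2beta`, cell `ym3-torus`, px16 g18); the seam
twist is written INLINE: `U ↦ fun b => (if b.dir = μ ∧ (b.src μ).val + 1 = P.sitesPerDir j then n1 else 1) * U b` (`n1` central,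
`n1·n1 = 1`).

* §2 ★ `countP_seam_axialWord` — the straight transport of the `L` fine bonds of a coarse bond `c` meets the fine seam exactly once when `c`
  crosses the coarse seam and not at all otherwise (lit ✓`val_emb`, ✓`sitesPerDir_eq_mul_succ`, ✓`two_le_sitesPerDir`); with the twist-blind
  weights of part I: ★★ `avgFun_seamTwist` ∕ `iter_seamTwist` — THE (0.4) AVERAGING INTERTWINES THE FINE AND THE COARSE SEAM TWISTS
  (standing range `j + 1 ≤ m + K`); `plaqHol_seamTwist` (every plaquette has 0 or 2 seam edges, which cancel by centrality),
  `plaqSmall_seamTwist_iff`, `wilsonAction4_seamTwist`, `seamTwist_seamTwist`.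
* §3 the T³ family: ★★ `descendTo_seamTwist` (lit ✓`descendTo_apply`, `bondShift`), `mem_fibre_seamTwist_iff`,
  `mem_histGood_seamTwist_iff`.

USE (next files of this seat): transport of the (T)-chain letters TUBE♭/GAP♭ from the flat datum `(1,1)` (✓`…S2BetaFlatGapOutright`) to the
seam sectors `(ζ_J, ζ_K)` and their residual-gauge orbits — the central-holonomy stratum of the per-datum table.

HONEST: lattice bookkeeping of the tree's OWN averaging (0.4) with its guard; nothing of Bałaban's analysis; this file proves NO stub of the
line — TUBE-REG∘, GAP♯∘, EXW∘, S2β and crux 20520 stay OPEN; rung R3 (YM₃ on T³) is NOT d = 4, NOT infinite volume, NOT a mass gap, NOT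
Clay; the Yang–Mills mass gap is NOT proved.
-/

set_option autoImplicit false

noncomputable section

open Set Function
open Literature.MathematicalPhysics.QuantumFieldTheory.Balaban1983to89
open Literature.MathematicalPhysics.QuantumFieldTheory.Balaban1983to89.T4Continuum
open Literature.MathematicalPhysics.QuantumFieldTheory.Balaban1983to89.AveragingRT
open Literature.MathematicalPhysics.QuantumFieldTheory.Balaban1983to89.BlockAveraging
open Literature.MathematicalPhysics.QuantumFieldTheory.Balaban1983to89.B10Eq27TorusAxialLog (holT holT_nil holT_cons_true holT_cons_false holT_eq_holAt)
open Literature.MathematicalPhysics.QuantumFieldTheory.Balaban1983to89.T3ContinuumYM3Torus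
open Literature.MathematicalPhysics.QuantumFieldTheory.Balaban1983to89.T3UnitScaleTilt
open Literature.MathematicalPhysics.QuantumFieldTheory.Balaban1983to89.T3TiltDescent
open Literature.MathematicalPhysics.QuantumFieldTheory.Balaban1983to89.T3LevelShift
open Literature.MathematicalPhysics.QuantumFieldTheory.Balaban1983to89.T3ConstrainedMinimiser (fibre)

open Summit.QuantumFields.YangMills.Theorems.FluctuationComparisonRegPrIntLS2BetaSeamTwistWords

namespace Summit.QuantumFields.YangMills.Theorems.FluctuationComparisonRegPrIntLS2BetaSeamTwistDescent

/-! ## §2 The straight transport of a coarse bond crosses the fine seam iff the coarse bond crosses the coarse seam -/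

section Axial

variable {P : Params} {j : ℕ} {G : Type*} [GaugeGroup G]

/-- Forward words make only forward steps. [folklore] -/
theorem countP_bwd_walk_replicate_true (μ ν : Fin P.d) :
    ∀ (n : ℕ) (x : Site P j), ((walk x (List.replicate n (ν, true))).countP
      fun s => !s.fwd && decide (s.bond.dir = μ ∧ (s.bond.src μ).val + 1 = P.sitesPerDir j)) = 0
  | 0, x => by simp [walk]
  | n + 1, x => by
    rw [List.replicate_succ, show walk x ((ν, true) :: List.replicate n (ν, true)) =
      ⟨⟨x, ν⟩, true⟩ :: walk (x.shift ν) (List.replicate n (ν, true)) from rfl, List.countP_cons,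
      countP_bwd_walk_replicate_true μ ν n (x.shift ν)]
    simp

/-- ★ **THE NUMBER OF FINE SEAM CROSSINGS OF THE STRAIGHT TRANSPORT OF A COARSE BOND** `c`: `1` if `c` is a wrapping bond of direction `μ` of the
coarse torus, `0` otherwise (centres sit at `nL + (L−1)/2`, lit ✓`val_emb`; `N_j = N_{j+1}·L`). [cite: Balaban1985Averaging, (15) p.20] -/
theorem countP_seam_axialWord (hj : j + 1 ≤ P.m + P.K) (μ : Fin P.d) (c : PBond P (j+1)) :
    ((walk (emb c.src) (List.replicate P.L (c.dir, true))).countP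
        fun s => decide (s.bond.dir = μ ∧ (s.bond.src μ).val + 1 = P.sitesPerDir j)) =
      if c.dir = μ ∧ (c.src μ).val + 1 = P.sitesPerDir (j+1) then 1 else 0 := by
  have hid := seam_crossing_identity (P := P) (j := j) μ (emb c.src) (List.replicate P.L (c.dir, true))
  rw [countP_bwd_walk_replicate_true μ c.dir, walkEnd_replicate_L, T4ReflectionCone.netDisp_replicate] at hid
  rw [countP_seam_eq_fwd_add_bwd, countP_bwd_walk_replicate_true μ c.dir, add_zero]
  set F := (walk (emb c.src) (List.replicate P.L (c.dir, true))).countP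
    fun s => s.fwd && decide (s.bond.dir = μ ∧ (s.bond.src μ).val + 1 = P.sitesPerDir j)
  have hN : (P.sitesPerDir j : ℤ) = (P.sitesPerDir (j+1) : ℤ) * P.L := by exact_mod_cast P.sitesPerDir_eq_mul_succ hj
  have hNpos : (0 : ℤ) < P.sitesPerDir j := by exact_mod_cast Nat.pos_of_ne_zero (P.sitesPerDir_ne_zero j)
  have hes : ((emb c.src μ).val : ℤ) = (c.src μ).val * P.L + ((P.L - 1) / 2 : ℕ) := by exact_mod_cast Site.val_emb hj c.src μ
  have het : ((emb (c.src.shift c.dir) μ).val : ℤ) = ((c.src.shift c.dir) μ).val * P.L + ((P.L - 1) / 2 : ℕ) := by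
    exact_mod_cast Site.val_emb hj (c.src.shift c.dir) μ
  simp only [Nat.cast_zero, sub_zero] at hid
  by_cases hdir : c.dir = μ
  · subst hdir
    have hvs := val_shift_self (P := P) (j := j+1) c.src c.dir
    simp only [↓reduceIte, mul_one, true_and] at hid ⊢
    by_cases hwrap : (c.src c.dir).val + 1 = P.sitesPerDir (j+1)
    · rw [if_pos hwrap] at hvs
      rw [if_pos hwrap]
      rw [hes, het, hvs] at hid
      push_cast at hid
      have hw' : ((c.src c.dir).val : ℤ) = (P.sitesPerDir (j+1) : ℤ) - 1 := by
        have := congrArg (fun n : ℕ => (n : ℤ)) hwrap; push_cast at this; linarith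
      rw [hw'] at hid
      have : (P.sitesPerDir j : ℤ) * ((F : ℤ) - 1) = 0 := by rw [hN] at hid ⊢; nlinarith [hid]
      have hF : (F : ℤ) = 1 := by
        rcases mul_eq_zero.mp this with h | h
        · exact absurd h (ne_of_gt hNpos)
        · linarith
      exact_mod_cast hF
    · rw [if_neg hwrap] at hvs
      rw [if_neg hwrap]
      rw [hes, het, hvs] at hid
      push_cast at hid
      have : (P.sitesPerDir j : ℤ) * (F : ℤ) = 0 := by nlinarith [hid]
      have hF : (F : ℤ) = 0 := by
        rcases mul_eq_zero.mp this with h | h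
        · exact absurd h (ne_of_gt hNpos)
        · exact h
      exact_mod_cast hF
  · have hd : ¬ (c.dir = μ ∧ (c.src μ).val + 1 = P.sitesPerDir (j+1)) := fun h => hdir h.1
    rw [if_neg hd]
    have htgt : ((c.src.shift c.dir) μ) = c.src μ := shift_apply_of_ne c.src (fun h => hdir h.symm)
    simp only [hdir, ↓reduceIte, mul_zero] at hid
    rw [het, htgt, hes, sub_self, sub_zero] at hid
    have : (P.sitesPerDir j : ℤ) * (F : ℤ) = 0 := by linarith
    have hF : (F : ℤ) = 0 := by
      rcases mul_eq_zero.mp this with h | h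
      · exact absurd h (ne_of_gt hNpos)
      · exact h
    exact_mod_cast hF

/-- ★ **THE STRAIGHT TRANSPORT PICKS UP `n1` EXACTLY ON THE COARSE SEAM**. [cite: Balaban1985Averaging, (15) p.20] -/
theorem axialAvg_seamTwist (hj : j + 1 ≤ P.m + P.K) (n1 : G) (hc : ∀ g : G, n1 * g = g * n1) (hsq : n1 * n1 = 1) (μ : Fin P.d)
    (U : GaugeField P j G) (c : PBond P (j+1)) :
    axialAvg (fun b : PBond P j => (if b.dir = μ ∧ (b.src μ).val + 1 = P.sitesPerDir j then n1 else 1) * U b) c =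
      (if c.dir = μ ∧ (c.src μ).val + 1 = P.sitesPerDir (j+1) then n1 else 1) * axialAvg U c := by
  rw [axialAvg_eq_holAt_walk, axialAvg_eq_holAt_walk, ← holT_eq_holAt, ← holT_eq_holAt,
    holT_seamTwist_count n1 hc hsq μ U, countP_seam_axialWord hj μ c]
  split_ifs <;> simp

/-- ★★ **THE BLOCK AVERAGING OF RECORD INTERTWINES THE FINE AND THE COARSE SEAM TWISTS** (standing range `j + 1 ≤ m + K`).
[cite: Balaban1987RG1, (0.4) p.253; Balaban1985Averaging, (15) p.20] -/
theorem avgFun_seamTwist (ℰ : LoopAverage G) (hj : j + 1 ≤ P.m + P.K) (n1 : G) (hc : ∀ g : G, n1 * g = g * n1) (hsq : n1 * n1 = 1)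
    (μ : Fin P.d) (U : GaugeField P j G) :
    avgFun ℰ (fun b : PBond P j => (if b.dir = μ ∧ (b.src μ).val + 1 = P.sitesPerDir j then n1 else 1) * U b) =
      fun c : PBond P (j+1) => (if c.dir = μ ∧ (c.src μ).val + 1 = P.sitesPerDir (j+1) then n1 else 1) * avgFun ℰ U c := by
  funext c
  show corr ℰ _ c * axialAvg _ c = (if c.dir = μ ∧ (c.src μ).val + 1 = P.sitesPerDir (j+1) then n1 else 1) * (corr ℰ U c * axialAvg U c)
  rw [corr_seamTwist ℰ n1 hc hsq μ U c, axialAvg_seamTwist hj n1 hc hsq μ U c, ← mul_assoc, ← mul_assoc,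
    ite_mul_comm' n1 hc _ (corr ℰ U c)]

/-- ★★ **… AND SO DOES THE ITERATED AVERAGING** (standing range `k ≤ m + K`). [cite: Balaban1987RG1, (0.11) p.253] -/
theorem iter_seamTwist (ℰ : LoopAverage G) (n1 : G) (hc : ∀ g : G, n1 * g = g * n1) (hsq : n1 * n1 = 1) (μ : Fin P.d) :
    ∀ (k : ℕ), k ≤ P.m + P.K → ∀ (U : GaugeField P 0 G),
      Averaging.iter (fun i => blockAvg (P := P) (j := i) ℰ) k
          (fun b : PBond P 0 => (if b.dir = μ ∧ (b.src μ).val + 1 = P.sitesPerDir 0 then n1 else 1) * U b) =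
        fun c : PBond P k => (if c.dir = μ ∧ (c.src μ).val + 1 = P.sitesPerDir k then n1 else 1) *
          Averaging.iter (fun i => blockAvg (P := P) (j := i) ℰ) k U c
  | 0, _, _ => rfl
  | k + 1, hk, U => by
    show (blockAvg ℰ).avg (Averaging.iter (fun i => blockAvg (P := P) (j := i) ℰ) k _) =
      fun c => (if c.dir = μ ∧ (c.src μ).val + 1 = P.sitesPerDir (k+1) then n1 else 1) *
        (blockAvg ℰ).avg (Averaging.iter (fun i => blockAvg (P := P) (j := i) ℰ) k U) c
    rw [iter_seamTwist ℰ n1 hc hsq μ k (Nat.le_of_succ_le hk) U, blockAvg_avg, avgFun_seamTwist ℰ hk n1 hc hsq μ]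

/-- Two central letters cancel in a plaquette-shaped product. [folklore] -/
theorem plaq_central_cancel' (a b W X Y Z : G) (ha : ∀ g : G, a * g = g * a) (hb : ∀ g : G, b * g = g * b) :
    a * W * (b * X) * (a * Y)⁻¹ * (b * Z)⁻¹ = W * X * Y⁻¹ * Z⁻¹ := by
  have hA : ∀ g t : G, g * (a⁻¹ * t) = a⁻¹ * (g * t) := fun g t => by
    rw [← mul_assoc, ← ((show Commute a g from ha g).inv_left).eq, mul_assoc]
  have hB : ∀ g t : G, g * (b⁻¹ * t) = b⁻¹ * (g * t) := fun g t => by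
    rw [← mul_assoc, ← ((show Commute b g from hb g).inv_left).eq, mul_assoc]
  have hB' : ∀ g : G, g * b⁻¹ = b⁻¹ * g := fun g => (((show Commute b g from hb g).inv_left).eq).symm
  rw [mul_inv_rev, mul_inv_rev]
  simp only [mul_assoc, hA, inv_mul_cancel_left]
  simp only [hB', hB, inv_mul_cancel_left]

/-- **EVERY PLAQUETTE VARIABLE IS SEAM-TWIST-INVARIANT**: the two `μ`-bonds of a plaquette lie over the same `x_μ`. [cite: Balaban1985Averaging, (9) p.19] -/
theorem plaqHol_seamTwist (n1 : G) (hc : ∀ g : G, n1 * g = g * n1) (μ : Fin P.d) (U : GaugeField P j G) (p : Plaq P j) :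
    GaugeField.plaqHol (fun b : PBond P j => (if b.dir = μ ∧ (b.src μ).val + 1 = P.sitesPerDir j then n1 else 1) * U b) p =
      GaugeField.plaqHol U p := by
  unfold GaugeField.plaqHol
  dsimp only
  by_cases hμν : p.μ = p.ν
  · -- degenerate plaquette: both sides collapse
    have e : (⟨p.src.shift p.ν, p.μ⟩ : PBond P j) = ⟨p.src.shift p.μ, p.ν⟩ := by rw [hμν]
    have e' : (⟨p.src, p.ν⟩ : PBond P j) = ⟨p.src, p.μ⟩ := by rw [hμν]
    simp only [hμν, mul_inv_cancel_right, mul_inv_rev]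
    group
  · have h13 : (p.μ = μ ∧ ((p.src.shift p.ν) μ).val + 1 = P.sitesPerDir j) ↔ (p.μ = μ ∧ (p.src μ).val + 1 = P.sitesPerDir j) := by
      by_cases h : p.μ = μ
      · have hne : μ ≠ p.ν := fun h' => hμν (h.trans h')
        rw [shift_apply_of_ne p.src hne]
      · simp [h]
    have h24 : (p.ν = μ ∧ ((p.src.shift p.μ) μ).val + 1 = P.sitesPerDir j) ↔ (p.ν = μ ∧ (p.src μ).val + 1 = P.sitesPerDir j) := by
      by_cases h : p.ν = μ
      · have hne : μ ≠ p.μ := fun h' => hμν (h'.symm.trans h.symm)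
        rw [shift_apply_of_ne p.src hne]
      · simp [h]
    rw [if_congr h13 rfl rfl, if_congr h24 rfl rfl]
    exact plaq_central_cancel' _ _ _ _ _ _ (ite_mul_comm' n1 hc _) (ite_mul_comm' n1 hc _)

/-- Hence `PlaqSmall` is seam-twist-invariant. [cite: Balaban1985UV3, (7) p.257] -/
theorem plaqSmall_seamTwist_iff (n1 : G) (hc : ∀ g : G, n1 * g = g * n1) (μ : Fin P.d) (δ : ℝ) (U : GaugeField P j G) :
    PlaqSmall δ (fun b : PBond P j => (if b.dir = μ ∧ (b.src μ).val + 1 = P.sitesPerDir j then n1 else 1) * U b) ↔ PlaqSmall δ U := by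
  simp only [PlaqSmall, plaqHol_seamTwist n1 hc μ U]

/-- … and so is the Wilson action. [cite: Balaban1985Variational, (1) p.278] -/
theorem wilsonAction4_seamTwist (n1 : G) (hc : ∀ g : G, n1 * g = g * n1) (μ : Fin P.d) (U : GaugeField P j G) :
    wilsonAction4 (fun b : PBond P j => (if b.dir = μ ∧ (b.src μ).val + 1 = P.sitesPerDir j then n1 else 1) * U b) = wilsonAction4 U := by
  simp only [wilsonAction4, wilsonAction, plaqHol_seamTwist n1 hc μ U]

/-- The seam twist is an involution. [folklore] -/
theorem seamTwist_seamTwist (n1 : G) (hsq : n1 * n1 = 1) (μ : Fin P.d) (U : GaugeField P j G) :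
    (fun b : PBond P j => (if b.dir = μ ∧ (b.src μ).val + 1 = P.sitesPerDir j then n1 else 1) *
      ((if b.dir = μ ∧ (b.src μ).val + 1 = P.sitesPerDir j then n1 else 1) * U b)) = U := by
  funext b
  rw [← mul_assoc]
  split_ifs
  · rw [hsq, one_mul]
  · rw [one_mul, one_mul]

end Axial

/-! ## §3 The T³ family: `descendTo`, the fibres, the good histories -/

section Family

variable (F : T3Family) {G : Type*} [GaugeGroup G] (ℰ : LoopAverage G)

/-- ★★ **`D_{n,K}` INTERTWINES THE SEAM TWISTS** of run `K`'s finest lattice and of the comparison lattice. [cite: Balaban1987RG1, (0.11) p.253; Balaban1985UV3, (1)-(3) p.256] -/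
theorem descendTo_seamTwist (n1 : G) (hc : ∀ g : G, n1 * g = g * n1) (hsq : n1 * n1 = 1) (μ : Fin 3) {n K : ℕ} (h : n ≤ K)
    (U : GaugeField (F.P K) 0 G) :
    descendTo F ℰ n K h (fun b : PBond (F.P K) 0 => (if b.dir = μ ∧ (b.src μ).val + 1 = (F.P K).sitesPerDir 0 then n1 else 1) * U b) =
      fun c : PBond (F.P n) 0 => (if c.dir = μ ∧ (c.src μ).val + 1 = (F.P n).sitesPerDir 0 then n1 else 1) * descendTo F ℰ n K h U c := by
  funext c
  have h1 := congrFun (iter_seamTwist (P := F.P K) ℰ n1 hc hsq μ (K - n) (by show K - n ≤ F.m + K; omega) U)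
    (bondShift (F.sitesPerDir_eq (m := F.m) (K := n) (j := 0) (m' := F.m) (K' := K) (j' := K - n) (by omega)) c)
  have hN : (F.P K).sitesPerDir (K - n) = (F.P n).sitesPerDir 0 :=
    (F.sitesPerDir_eq (m := F.m) (K := n) (j := 0) (m' := F.m) (K' := K) (j' := K - n) (by omega)).symm
  unfold descendTo
  rw [fieldShift_apply, fieldShift_apply, h1]
  congr 1
  refine if_congr ?_ rfl rfl
  simp only [bondShift_dir, bondShift_src, siteShift_apply, hN]
  erw [coordEquiv_val]
  exact Iff.rfl

/-- **THE FIBRES ARE PERMUTED**. [cite: Balaban1985Variational, (3) p.278] -/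
theorem mem_fibre_seamTwist_iff (n1 : G) (hc : ∀ g : G, n1 * g = g * n1) (hsq : n1 * n1 = 1) (μ : Fin 3) {n K : ℕ} (h : n ≤ K)
    (U : GaugeField (F.P K) 0 G) (V : GaugeField (F.P n) 0 G) :
    (fun b : PBond (F.P K) 0 => (if b.dir = μ ∧ (b.src μ).val + 1 = (F.P K).sitesPerDir 0 then n1 else 1) * U b) ∈
        fibre F ℰ n K h (fun c : PBond (F.P n) 0 => (if c.dir = μ ∧ (c.src μ).val + 1 = (F.P n).sitesPerDir 0 then n1 else 1) * V c) ↔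
      U ∈ fibre F ℰ n K h V := by
  show descendTo F ℰ n K h _ = _ ↔ descendTo F ℰ n K h U = V
  rw [descendTo_seamTwist F ℰ n1 hc hsq μ h U]
  constructor
  · intro hUV
    funext c
    exact mul_left_cancel (congrFun hUV c)
  · intro hUV
    rw [hUV]

/-- **THE GOOD HISTORIES ARE SEAM-TWIST-INVARIANT**. [cite: Balaban1985UV3, (7) p.257] -/
theorem mem_histGood_seamTwist_iff (n1 : G) (hc : ∀ g : G, n1 * g = g * n1) (hsq : n1 * n1 = 1) (μ : Fin 3) (θ : ℕ → ℝ) {K : ℕ} (n : ℕ)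
    (U : GaugeField (F.P K) 0 G) :
    (fun b : PBond (F.P K) 0 => (if b.dir = μ ∧ (b.src μ).val + 1 = (F.P K).sitesPerDir 0 then n1 else 1) * U b) ∈ histGood F ℰ θ K n ↔
      U ∈ histGood F ℰ θ K n := by
  unfold histGood
  simp only [Set.mem_setOf_eq]
  refine forall_congr' fun j => forall_congr' fun hj => ?_
  rw [iter_seamTwist (P := F.P K) ℰ n1 hc hsq μ j (by show j ≤ F.m + K; omega) U]
  exact plaqSmall_seamTwist_iff (P := F.P K) n1 hc μ _ _

end Family

end Summit.QuantumFields.YangMills.Theorems.FluctuationComparisonRegPrIntLS2BetaSeamTwistDescent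

end
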